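import Summits.CriticalPhenomena.PercolationContinuityZ3.Theorems.SahiCISCoupling
import Mathlib.MeasureTheory.Measure.ProbabilityMeasure

/-!
# CIS in the kernel sense is NOT closed under weak convergence in dimension `3` — I: the four-atom laws

Cell `prim-sahi`, typer (generation 17); `--supports stmt-CriticalPhenomena-4575`.  No named facts, no sorries.
Part I (this file): the laws, their kernels, and CIS for `s < t`.  Part II (`SahiCISNonClosure.lean`): failure of
CIS for `s = t`, weak convergence, and the non-closure theorem.

Colangelo–Müller–Scarsini (J. Appl. Probab. 43 (2006), Thm. 5) prove that their density-free Definition 4 of CIS is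
closed under weak convergence.  Definition 4, however, is strictly weaker than CIS in dimension `≥ 3` (it never compares
conditioning points sharing a coordinate; `SahiCISDefinitionFour.lean`).  Here we show that NO notion of CIS that
implies the kernel form (Theorem 4 (b) of the source: stochastically increasing disintegration kernels — everywhere,
on a full-measure set, or on almost every pair, `IsCISae` of `SahiCISCoupling.lean`) can be weakly closed in dimension
`3`:

* `fourAtomLaw s t` — the law on `Q_3 = [0,1]³` of `(X₀, X₁, X₂)` with `X₀ = s` or `t` (a fair coin), `X₁ | X₀ = s`
  uniform on `{0, ¾}`, `X₁ | X₀ = t` uniform on `{¼, 1}`, and `X₂ = 𝟙{X₀-branch = t}`.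
* `isCISae_fourAtomLaw` — for `s < t` the law is CIS, with EVERYWHERE stochastically increasing kernels (the
  conditioning points `(s, ¾)` and `(t, ¼)` are incomparable): `kernelOne t` = `½δ_{¼} + ½δ_1` above the threshold
  `x₀ ≥ t`, `½δ_0 + ½δ_{¾}` below; `kernelTwo t` = `δ_1` on the up-set `{x₀ ≥ t, x₁ ≥ ¼}`, `δ_0` elsewhere.
* `not_isCISae_fourAtomLaw_self` — for `s = t` it is NOT `IsCISae` (a fortiori admits no everywhere-monotone kernels):
  the merged conditioning atoms `(s, ¼) ≤ (s, ¾)` carry the conditional laws `δ_1`, `δ_0` of `X₂`, and form an atom of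
  `μ^{(2)} ⊗ μ^{(2)}`.
* `tendsto_fourAtomLaw` — `fourAtomLaw 0 (1/(n+1)) → fourAtomLaw 0 0` weakly (atoms move continuously); hence
  **`exists_isCISae_tendsto_not_isCISae`: a weakly convergent sequence of CIS laws on `[0,1]³` with a non-CIS limit.**
  (In dimension `2` the conditioning space is totally ordered and CIS = cut-TP₂ IS weakly closed:
  `CISWeakClosure.lean` / `SahiTP2CIS.lean`.)  Positive association and Sahi positivity of order `n`, by contrast, ARE
  weakly closed (`PositiveAssociationLimits`, `SahiPositivityWeakLimits.lean`), so weak limits of CIS laws keep those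
  consequences without being CIS.

References: Colangelo–Müller–Scarsini 2006, §4 Thm. 4 (b), Thm. 5 [ColangeloMullerScarsini2006]; Müller–Stoyan 2002,
Def. 3.10.9 [MullerStoyan2002].  The example is this work.
-/

noncomputable section

namespace Summit.CriticalPhenomena.PercolationContinuityZ3.Theorems.SahiCIS

open MeasureTheory ProbabilityTheory Set Filter Topology Function
open Summit.CriticalPhenomena.PercolationContinuityZ3.Theorems.SahiBoxTP2
open scoped ENNReal unitInterval BoundedContinuousFunction

/-! ### Generic facts -/

section Generic

variable {α β : Type*} [MeasurableSpace α] [MeasurableSpace β]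

/-- `δ_a ⊗ₘ κ = (κ a) ∘ (a, ·)⁻¹`. [folklore] -/
theorem dirac_compProd_eq_map [MeasurableSingletonClass α] (a : α) (κ : Kernel α β) [IsSFiniteKernel κ] :
    Measure.dirac a ⊗ₘ κ = (κ a).map (Prod.mk a) := by
  ext s hs
  rw [Measure.dirac_compProd_apply hs, Measure.map_apply measurable_prodMk_left hs]

/-- An a.e. statement holds at an atom. [folklore] -/
theorem of_ae_of_measure_singleton_ne_zero {μ : Measure α} {P : α → Prop} (h : ∀ᵐ x ∂μ, P x) {a : α}
    (ha : μ {a} ≠ 0) : P a := by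
  by_contra hPa
  exact ha (measure_mono_null (fun x hx => by rw [mem_singleton_iff.1 hx]; exact hPa) (ae_iff.1 h))

/-- Over a conditioning space with at most one point, every kernel is stochastically increasing on almost every pair.
[folklore] -/
theorem aepairMonoKernel_of_subsingleton {Ω : Type*} [MeasurableSpace Ω] [Preorder Ω] [Subsingleton Ω]
    (ν : Measure Ω) (κ : Kernel Ω I) : AEPairMonoKernel ν κ :=
  ae_of_all _ fun p _ x => by rw [Subsingleton.elim p.2 p.1]

/-- **Every finite measure on `Q_1 = [0,1]` is `IsCISae 1`** (nothing to condition on). [this work] -/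
theorem isCISae_one (μ : Measure (Fin 1 → I)) [IsFiniteMeasure μ] : IsCISae 1 μ := by
  rw [isCISae_succ_iff_condKernel]
  exact ⟨isCISae_zero _, aepairMonoKernel_of_subsingleton _ _⟩

end Generic

/-! ### The atoms -/

section Atoms

/-- The point `¼ ∈ [0,1]`. -/
def pt14 : I := ⟨4⁻¹, by rw [Set.mem_Icc]; norm_num⟩

/-- The point `¾ ∈ [0,1]`. -/
def pt34 : I := ⟨3 / 4, by rw [Set.mem_Icc]; norm_num⟩

/-- `¼ ≤ ¾`. [folklore] -/
theorem pt14_le_pt34 : pt14 ≤ pt34 := by change (4⁻¹ : ℝ) ≤ 3 / 4; norm_num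
/-- `¼ < 1`. [folklore] -/
theorem pt14_lt_top : pt14 < ⊤ := by change (4⁻¹ : ℝ) < 1; norm_num
/-- `0 < ¼`. [folklore] -/
theorem bot_lt_pt14 : ⊥ < pt14 := by change (0 : ℝ) < 4⁻¹; norm_num
/-- `¾ < 1`. [folklore] -/
theorem pt34_lt_top : pt34 < ⊤ := by change (3 / 4 : ℝ) < 1; norm_num
/-- `¼ ≠ ¾`. [folklore] -/
theorem pt14_ne_pt34 : pt14 ≠ pt34 := fun h => by have := congrArg Subtype.val h; change (4⁻¹ : ℝ) = 3 / 4 at this; norm_num at this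

/-- `initLast (a, b, c) = ((a, b), c)` on `Q_3`. [folklore] -/
theorem initLast_vec3 (a b c : I) : initLast (![a, b, c] : Fin 3 → I) = (![a, b], c) :=
  Prod.ext (funext fun i => by refine Fin.cases rfl (fun j => ?_) i; exact Fin.cases rfl (fun k => k.elim0) j) rfl

/-- `initLast (a, b) = ((a), b)` on `Q_2`. [folklore] -/
theorem initLast_vec2 (a b : I) : initLast (![a, b] : Fin 2 → I) = (![a], b) :=
  Prod.ext (funext fun i => by exact Fin.cases rfl (fun k => k.elim0) i) rfl

end Atoms

/-! ### The laws and kernels -/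

section Laws

/-- The conditional law of `X₁` on the lower branch: uniform on `{0, ¾}`. [this work] -/
def lawLow : Measure I := (2⁻¹ : ℝ≥0∞) • (Measure.dirac ⊥ + Measure.dirac pt34)

/-- The conditional law of `X₁` on the upper branch: uniform on `{¼, 1}`. [this work] -/
def lawHigh : Measure I := (2⁻¹ : ℝ≥0∞) • (Measure.dirac pt14 + Measure.dirac ⊤)

/-- **The example** `fourAtomLaw s t` on `Q_3`: `X₀ ∈ {s, t}` a fair coin; given the branch `s`, `X₁` uniform on
`{0, ¾}` and `X₂ = 0`; given the branch `t`, `X₁` uniform on `{¼, 1}` and `X₂ = 1`. [this work] -/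
def fourAtomLaw (s t : I) : Measure (Fin 3 → I) :=
  (2⁻¹ : ℝ≥0∞) • ((2⁻¹ : ℝ≥0∞) • (Measure.dirac ![s, ⊥, ⊥] + Measure.dirac ![s, pt34, ⊥]) +
    (2⁻¹ : ℝ≥0∞) • (Measure.dirac ![t, pt14, ⊤] + Measure.dirac ![t, ⊤, ⊤]))

/-- The law of `(X₀, X₁)` under `fourAtomLaw s t`. [this work] -/
def twoAtomLaw (s t : I) : Measure (Fin 2 → I) :=
  (2⁻¹ : ℝ≥0∞) • ((2⁻¹ : ℝ≥0∞) • (Measure.dirac ![s, ⊥] + Measure.dirac ![s, pt34]) +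
    (2⁻¹ : ℝ≥0∞) • (Measure.dirac ![t, pt14] + Measure.dirac ![t, ⊤]))

/-- The law of `X₀` under `fourAtomLaw s t`: a fair coin on `{s, t}`. [this work] -/
def coinLaw (s t : I) : Measure (Fin 1 → I) :=
  (2⁻¹ : ℝ≥0∞) • (Measure.dirac ![s] + Measure.dirac ![t])

/-- The kernel of `X₁` given `X₀`: the upper branch law at and above the threshold `t`, the lower one below.
[this work] -/
def kernelOne (t : I) : Kernel (Fin 1 → I) I :=
  @Kernel.piecewise _ _ _ _ {a : Fin 1 → I | t ≤ a 0} (fun _ => Classical.propDecidable _)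
    (measurableSet_le measurable_const (measurable_pi_apply (0 : Fin 1)))
    (Kernel.const _ lawHigh) (Kernel.const _ lawLow)

/-- The threshold up-set `{x₀ ≥ t} ∩ {x₁ ≥ ¼}` of `Q_2`. [this work] -/
def upperCorner (t : I) : Set (Fin 2 → I) := {a : Fin 2 → I | t ≤ a 0} ∩ {a : Fin 2 → I | pt14 ≤ a 1}

/-- The threshold up-set is measurable. [folklore] -/
theorem measurableSet_upperCorner (t : I) : MeasurableSet (upperCorner t) :=
  (measurableSet_le measurable_const (measurable_pi_apply (0 : Fin 2))).inter
    (measurableSet_le measurable_const (measurable_pi_apply (1 : Fin 2)))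

/-- The kernel of `X₂` given `(X₀, X₁)`: `δ_1` on the up-set `{x₀ ≥ t, x₁ ≥ ¼}`, `δ_0` elsewhere. [this work] -/
def kernelTwo (t : I) : Kernel (Fin 2 → I) I :=
  @Kernel.piecewise _ _ _ _ (upperCorner t) (fun _ => Classical.propDecidable _) (measurableSet_upperCorner t)
    (Kernel.const _ (Measure.dirac ⊤)) (Kernel.const _ (Measure.dirac ⊥))

/-- `½ (1 + 1) = 1` in `ℝ≥0∞`. [folklore] -/
theorem inv_two_mul_one_add_one : (2⁻¹ : ℝ≥0∞) * (1 + 1) = 1 := by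
  rw [one_add_one_eq_two, ENNReal.inv_mul_cancel (by norm_num) (by norm_num)]

/-- `½ (X + X) = X` for measures. [folklore] -/
theorem inv_two_smul_add_self {α : Type*} [MeasurableSpace α] (X : Measure α) :
    (2⁻¹ : ℝ≥0∞) • (X + X) = X := by
  rw [smul_add, ← add_smul, ENNReal.inv_two_add_inv_two, one_smul]

/-- `lawLow` is a probability measure. [folklore] -/
instance isProbabilityMeasure_lawLow : IsProbabilityMeasure lawLow := by
  refine ⟨?_⟩
  simp only [lawLow, Measure.coe_smul, Measure.coe_add, Pi.smul_apply, Pi.add_apply, measure_univ, smul_eq_mul]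
  exact inv_two_mul_one_add_one

/-- `lawHigh` is a probability measure. [folklore] -/
instance isProbabilityMeasure_lawHigh : IsProbabilityMeasure lawHigh := by
  refine ⟨?_⟩
  simp only [lawHigh, Measure.coe_smul, Measure.coe_add, Pi.smul_apply, Pi.add_apply, measure_univ, smul_eq_mul]
  exact inv_two_mul_one_add_one

/-- `coinLaw` is a probability measure. [folklore] -/
instance isProbabilityMeasure_coinLaw (s t : I) : IsProbabilityMeasure (coinLaw s t) := by
  refine ⟨?_⟩
  simp only [coinLaw, Measure.coe_smul, Measure.coe_add, Pi.smul_apply, Pi.add_apply, measure_univ, smul_eq_mul]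
  exact inv_two_mul_one_add_one

/-- `twoAtomLaw` is a probability measure. [folklore] -/
instance isProbabilityMeasure_twoAtomLaw (s t : I) : IsProbabilityMeasure (twoAtomLaw s t) := by
  refine ⟨?_⟩
  simp only [twoAtomLaw, Measure.coe_smul, Measure.coe_add, Pi.smul_apply, Pi.add_apply, measure_univ, smul_eq_mul]
  rw [inv_two_mul_one_add_one]; exact inv_two_mul_one_add_one

/-- `fourAtomLaw` is a probability measure. [folklore] -/
instance isProbabilityMeasure_fourAtomLaw (s t : I) : IsProbabilityMeasure (fourAtomLaw s t) := by
  refine ⟨?_⟩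
  simp only [fourAtomLaw, Measure.coe_smul, Measure.coe_add, Pi.smul_apply, Pi.add_apply, measure_univ, smul_eq_mul]
  rw [inv_two_mul_one_add_one]; exact inv_two_mul_one_add_one

/-- `kernelOne` is Markov. [folklore] -/
instance isMarkovKernel_kernelOne (t : I) : IsMarkovKernel (kernelOne t) := by
  unfold kernelOne; infer_instance

/-- `kernelTwo` is Markov. [folklore] -/
instance isMarkovKernel_kernelTwo (t : I) : IsMarkovKernel (kernelTwo t) := by
  unfold kernelTwo; infer_instance

/-- Value of `kernelOne` at and above the threshold. [this work] -/
theorem kernelOne_apply_of_le (t : I) {a : Fin 1 → I} (h : t ≤ a 0) : kernelOne t a = lawHigh := by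
  simp only [kernelOne, Kernel.piecewise_apply, Kernel.const_apply, Set.mem_setOf_eq]
  exact if_pos h

/-- Value of `kernelOne` below the threshold. [this work] -/
theorem kernelOne_apply_of_not_le (t : I) {a : Fin 1 → I} (h : ¬ t ≤ a 0) : kernelOne t a = lawLow := by
  simp only [kernelOne, Kernel.piecewise_apply, Kernel.const_apply, Set.mem_setOf_eq]
  exact if_neg h

/-- Value of `kernelTwo` on the threshold up-set. [this work] -/
theorem kernelTwo_apply_of_mem (t : I) {a : Fin 2 → I} (h : a ∈ upperCorner t) : kernelTwo t a = Measure.dirac ⊤ := by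
  simp only [kernelTwo, Kernel.piecewise_apply, Kernel.const_apply]
  exact if_pos h

/-- Value of `kernelTwo` off the threshold up-set. [this work] -/
theorem kernelTwo_apply_of_not_mem (t : I) {a : Fin 2 → I} (h : a ∉ upperCorner t) :
    kernelTwo t a = Measure.dirac ⊥ := by
  simp only [kernelTwo, Kernel.piecewise_apply, Kernel.const_apply]
  exact if_neg h

/-- The threshold up-set is an up-set. [folklore] -/
theorem upperCorner_mono (t : I) {a b : Fin 2 → I} (hab : a ≤ b) (ha : a ∈ upperCorner t) : b ∈ upperCorner t :=
  ⟨le_trans (show t ≤ a 0 from ha.1) (hab 0), le_trans (show pt14 ≤ a 1 from ha.2) (hab 1)⟩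

/-! #### Marginals -/

/-- The law of `((X₀, X₁), X₂)`. [this work] -/
theorem fourAtomLaw_map_initLast (s t : I) :
    (fourAtomLaw s t).map initLast =
      (2⁻¹ : ℝ≥0∞) • ((2⁻¹ : ℝ≥0∞) • (Measure.dirac ((![s, ⊥] : Fin 2 → I), (⊥ : I)) +
          Measure.dirac ((![s, pt34] : Fin 2 → I), (⊥ : I))) +
        (2⁻¹ : ℝ≥0∞) • (Measure.dirac ((![t, pt14] : Fin 2 → I), (⊤ : I)) +
          Measure.dirac ((![t, ⊤] : Fin 2 → I), (⊤ : I)))) := by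
  have hm : Measurable (initLast (d := 2)) := measurable_initLast
  simp only [fourAtomLaw, Measure.map_smul, Measure.map_add _ _ hm, Measure.map_dirac' hm, initLast_vec3]

/-- Its first marginal is `twoAtomLaw s t`. [this work] -/
theorem fourAtomLaw_map_initLast_fst (s t : I) : ((fourAtomLaw s t).map initLast).fst = twoAtomLaw s t := by
  rw [fourAtomLaw_map_initLast, Measure.fst]
  simp only [Measure.map_smul, Measure.map_add _ _ measurable_fst, Measure.map_dirac' measurable_fst, twoAtomLaw]

/-- The law of `((X₀), X₁)`. [this work] -/
theorem twoAtomLaw_map_initLast (s t : I) :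
    (twoAtomLaw s t).map initLast =
      (2⁻¹ : ℝ≥0∞) • ((2⁻¹ : ℝ≥0∞) • (Measure.dirac ((![s] : Fin 1 → I), (⊥ : I)) +
          Measure.dirac ((![s] : Fin 1 → I), pt34)) +
        (2⁻¹ : ℝ≥0∞) • (Measure.dirac ((![t] : Fin 1 → I), pt14) + Measure.dirac ((![t] : Fin 1 → I), (⊤ : I)))) := by
  have hm : Measurable (initLast (d := 1)) := measurable_initLast
  simp only [twoAtomLaw, Measure.map_smul, Measure.map_add _ _ hm, Measure.map_dirac' hm, initLast_vec2]

/-- Its first marginal is the coin. [this work] -/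
theorem twoAtomLaw_map_initLast_fst (s t : I) : ((twoAtomLaw s t).map initLast).fst = coinLaw s t := by
  rw [twoAtomLaw_map_initLast, Measure.fst]
  simp only [Measure.map_smul, Measure.map_add _ _ measurable_fst, Measure.map_dirac' measurable_fst]
  rw [inv_two_smul_add_self, inv_two_smul_add_self, coinLaw]

/-! #### The disintegrations (for `s < t`) -/

/-- `coinLaw ⊗ₘ kernelOne = law of ((X₀), X₁)` when `s < t`. [this work] -/
theorem coinLaw_compProd_kernelOne {s t : I} (hst : s < t) :
    coinLaw s t ⊗ₘ kernelOne t = (twoAtomLaw s t).map initLast := by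
  have hs : kernelOne t ![s] = lawLow := kernelOne_apply_of_not_le t (not_le.2 hst)
  have ht : kernelOne t ![t] = lawHigh := kernelOne_apply_of_le t le_rfl
  rw [twoAtomLaw_map_initLast, coinLaw, Measure.compProd_smul_left, Measure.compProd_add_left,
    dirac_compProd_eq_map, dirac_compProd_eq_map, hs, ht, lawLow, lawHigh]
  simp only [Measure.map_smul, Measure.map_add _ _ measurable_prodMk_left, Measure.map_dirac' measurable_prodMk_left]

/-- `twoAtomLaw ⊗ₘ kernelTwo = law of ((X₀, X₁), X₂)` when `s < t`. [this work] -/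
theorem twoAtomLaw_compProd_kernelTwo {s t : I} (hst : s < t) :
    twoAtomLaw s t ⊗ₘ kernelTwo t = (fourAtomLaw s t).map initLast := by
  have h1 : kernelTwo t ![s, ⊥] = Measure.dirac ⊥ :=
    kernelTwo_apply_of_not_mem t fun h => not_le.2 hst h.1
  have h2 : kernelTwo t ![s, pt34] = Measure.dirac ⊥ :=
    kernelTwo_apply_of_not_mem t fun h => not_le.2 hst h.1
  have h3 : kernelTwo t ![t, pt14] = Measure.dirac ⊤ :=
    kernelTwo_apply_of_mem t ⟨(le_rfl : t ≤ t), (le_rfl : pt14 ≤ pt14)⟩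
  have h4 : kernelTwo t ![t, ⊤] = Measure.dirac ⊤ :=
    kernelTwo_apply_of_mem t ⟨(le_rfl : t ≤ t), (le_top : pt14 ≤ ⊤)⟩
  rw [fourAtomLaw_map_initLast, twoAtomLaw, Measure.compProd_smul_left, Measure.compProd_add_left,
    Measure.compProd_smul_left, Measure.compProd_smul_left, Measure.compProd_add_left, Measure.compProd_add_left,
    dirac_compProd_eq_map, dirac_compProd_eq_map, dirac_compProd_eq_map, dirac_compProd_eq_map, h1, h2, h3, h4]
  simp only [Measure.map_dirac' measurable_prodMk_left]

/-! #### Monotonicity of the kernels -/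

/-- `lawHigh` dominates `lawLow`: `lawHigh([0,x]) ≤ lawLow([0,x])`. [this work] -/
theorem lawHigh_Iic_le_lawLow_Iic (x : I) : lawHigh (Iic x) ≤ lawLow (Iic x) := by
  simp only [lawHigh, lawLow, Measure.coe_smul, Measure.coe_add, Pi.smul_apply, Pi.add_apply, smul_eq_mul,
    Measure.dirac_apply' _ measurableSet_Iic]
  gcongr
  · rw [indicator_of_mem (Set.mem_Iic.2 (bot_le : (⊥ : I) ≤ x))]
    exact indicator_le_self' (fun _ _ => zero_le_one) _
  · by_cases hx : (⊤ : I) ∈ Iic x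
    · have hx' : x = ⊤ := top_le_iff.1 hx
      rw [indicator_of_mem hx, indicator_of_mem (Set.mem_Iic.2 (hx'.symm ▸ le_top : pt34 ≤ x)), Pi.one_apply,
        Pi.one_apply]
    · rw [indicator_of_notMem hx]; exact bot_le

/-- `kernelOne` is stochastically increasing everywhere. [this work] -/
theorem kernelOne_mono (t : I) ⦃a b : Fin 1 → I⦄ (hab : a ≤ b) (x : I) :
    kernelOne t b (Iic x) ≤ kernelOne t a (Iic x) := by
  by_cases ha : t ≤ a 0
  · rw [kernelOne_apply_of_le t ha, kernelOne_apply_of_le t (ha.trans (hab 0))]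
  · rw [kernelOne_apply_of_not_le t ha]
    by_cases hb : t ≤ b 0
    · rw [kernelOne_apply_of_le t hb]; exact lawHigh_Iic_le_lawLow_Iic x
    · rw [kernelOne_apply_of_not_le t hb]

/-- `kernelTwo` is stochastically increasing everywhere. [this work] -/
theorem kernelTwo_mono (t : I) ⦃a b : Fin 2 → I⦄ (hab : a ≤ b) (x : I) :
    kernelTwo t b (Iic x) ≤ kernelTwo t a (Iic x) := by
  by_cases ha : a ∈ upperCorner t
  · rw [kernelTwo_apply_of_mem t ha, kernelTwo_apply_of_mem t (upperCorner_mono t hab ha)]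
  · rw [kernelTwo_apply_of_not_mem t ha]
    by_cases hb : b ∈ upperCorner t
    · rw [kernelTwo_apply_of_mem t hb, Measure.dirac_apply' _ measurableSet_Iic, Measure.dirac_apply' _ measurableSet_Iic,
        indicator_of_mem (Set.mem_Iic.2 (bot_le : (⊥ : I) ≤ x))]
      exact indicator_le_self' (fun _ _ => zero_le_one) _
    · rw [kernelTwo_apply_of_not_mem t hb]

/-! #### CIS for `s < t`, not CIS for `s = t` -/

/-- **For `s < t` the four-atom law is CIS** (`IsCISae 3`, indeed with everywhere stochastically increasing kernels).
[this work] -/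
theorem isCISae_fourAtomLaw {s t : I} (hst : s < t) : IsCISae 3 (fourAtomLaw s t) := by
  have h2 : IsCISae 2 (twoAtomLaw s t) := by
    refine isCISae_succ_of_kernel ?_ (kernelOne t) ?_ (AEPairMonoKernel.of_forall (kernelOne_mono t))
    · rw [twoAtomLaw_map_initLast_fst]; exact isCISae_one _
    · rw [twoAtomLaw_map_initLast_fst]; exact coinLaw_compProd_kernelOne hst
  refine isCISae_succ_of_kernel ?_ (kernelTwo t) ?_ (AEPairMonoKernel.of_forall (kernelTwo_mono t))
  · rw [fourAtomLaw_map_initLast_fst]; exact h2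
  · rw [fourAtomLaw_map_initLast_fst]; exact twoAtomLaw_compProd_kernelTwo hst

end Laws

end Summit.CriticalPhenomena.PercolationContinuityZ3.Theorems.SahiCIS

end
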